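import Summits.MatrixMultiplication.MatrixMultiplication.Theorems.SoloInformedNearRectAssembly
import Summits.MatrixMultiplication.MatrixMultiplication.Theorems.SoloInformedRectangle

/-!
# THEOREM 8.19, degenerate variant `v ∼ v′`: the zero-pinned half is an exact column-class rectangle

This work, §8.8 (T13)(i) and C3-m2 §5.7 (gen 107). Setting: a CU13-Def-12 realization of `⟨n,n,n⟩` in
`𝒮(S⁰ × S¹, ±)` [CohnUmans2013, arXiv:1207.6528, Def. 12] — equation data `D : Data ι G` (no 2-torsion), a chart
`Φ`, full separation, class map `κ : G → R`.

When the two near-constant classes coincide (`a ≈ [v]` on `I₀ × 𝓛`, `b ≈ [v]` on `𝓛 × K₀`, `v ≠ 0`), the pinned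
classes of the `c`-rows are `[2v]` and `[0]`. The `[2v]` half is `Data.nearRect_core` verbatim (its table needs only
`v, v′, v+v′ ≠ 0`). The `[0]` half is RIGID: `c = 0` on the good cells, two rows sharing a zero of `c` have
class-equal `a`-entries in EVERY column (`Data.a_signEq_a_of_c_zero`), so off `≤ 2e` rows `a` is column-class
constant on `I₁ × ι` and the rectangle bound (T5) ends (`Data.sq_mul_min_le_of_zero_pinned`).
`Data.nearRect_same` assembles `K₀ = K_c ⊔ K₊ ⊔ K₀` exactly as `Data.nearRect`; `Data.nearRect_signEq` is the
`v′ ∼ v` form.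
-/

namespace Summit.MatrixMultiplication.MatrixMultiplication.Theorems.TwistedTPP

namespace FibreLines

variable {ι G : Type*} [AddCommGroup G]

/-- `Adm x v 0 ⟹ x ∼ v`. -/
theorem signEq_of_adm_zero_right {x v : G} (h : Adm x v 0) : SignEq x v := by
  rcases h with h | h | h | h
  · right; rw [add_zero] at h; exact eq_neg_of_add_eq_zero_left h
  · right; rw [sub_zero] at h; exact eq_neg_of_add_eq_zero_left h
  · left; rw [add_zero, sub_eq_zero] at h; exact h
  · left; rw [sub_zero, sub_eq_zero] at h; exact h

/-- Two rows sharing a zero of `c` in column `k` have class-equal `a`-entries in every column. -/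
theorem Data.a_signEq_a_of_c_zero (D : Data ι G) {i i' k : ι} (hi : D.c k i = 0) (hi' : D.c k i' = 0)
    (j : ι) : SignEq (D.a i j) (D.a i' j) := by
  have h1 : SignEq (D.a i j) (D.b j k) := by
    have e := D.adm_eqn i j k; rw [hi] at e; exact signEq_of_adm_zero_right e
  have h2 : SignEq (D.a i' j) (D.b j k) := by
    have e := D.adm_eqn i' j k; rw [hi'] at e; exact signEq_of_adm_zero_right e
  exact h1.trans h2.symm

variable {G₀ : Type*} [AddCommGroup G₀] {R : Type*}

/-- **The zero-pinned half.** If every `k ∈ K₁` has `c(k,i) = 0` on the rows `i ∈ I₀` conforming at a row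
`jd k ∈ 𝓛` (whose `a`-column misses `≤ e` rows of `I₀`), and `|K₁| > 2e`, then off `≤ 2e` rows `a` is column-class
constant on `I₁ × ι`, whence `n² · min(|I₁|, n/2) ≤ 2 · r · |S⁰|`. [C3-m2 §5.7] -/
theorem Data.sq_mul_min_le_of_zero_pinned [Fintype ι] [DecidableEq ι] [Fintype G₀] [DecidableEq G₀]
    [Fintype R] [DecidableEq R] (hG : ∀ x : G, x = -x → x = 0) (D : Data ι G) (Φ : Chart ι G₀)
    (κ : G → R) (hκ : ∀ x y, κ x = κ y → SignEq x y) (hsep : D.SepAll Φ) {v' : G}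
    (I₀ L K₁ : Finset ι) (e : ℕ) (jd : ι → ι) (hjd : ∀ k ∈ K₁, jd k ∈ L)
    (hac : ∀ j ∈ L, ∃ E : Finset ι, E.card ≤ e ∧ ∀ i ∈ I₀, i ∉ E → SignEq (D.a i j) v')
    (hpin : ∀ k ∈ K₁, ∀ i ∈ I₀, SignEq (D.a i (jd k)) v' → D.c k i = 0) (hK : 2 * e < K₁.card) :
    ∃ I₁ ⊆ I₀, I₀.card ≤ I₁.card + 2 * e ∧
      Fintype.card ι ^ 2 * min I₁.card (Fintype.card ι / 2) ≤ 2 * (Fintype.card R * Fintype.card G₀) := by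
  classical
  set bad : ι → Finset ι := fun i => K₁.filter fun k => ¬ SignEq (D.a i (jd k)) v' with hbad
  set I₁ : Finset ι := I₀.filter fun i => 2 * (bad i).card < K₁.card with hI₁
  have hI₁sub : I₁ ⊆ I₀ := Finset.filter_subset _ _
  refine ⟨I₁, hI₁sub, ?_, ?_⟩
  · set Ib : Finset ι := I₀.filter fun i => ¬ 2 * (bad i).card < K₁.card with hIb
    have hsplit : I₁.card + Ib.card = I₀.card := Finset.card_filter_add_card_filter_not _
    have hcount : Ib.card • ((K₁.card + 1) / 2) ≤ K₁.card • e := by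
      refine Finset.card_nsmul_le_card_nsmul (r := fun i k => ¬ SignEq (D.a i (jd k)) v') ?_ ?_
      · intro i hi
        have hge : ¬ 2 * (bad i).card < K₁.card := (Finset.mem_filter.1 hi).2
        have hb' : bad i = K₁.bipartiteAbove (fun i k => ¬ SignEq (D.a i (jd k)) v') i := rfl
        have h1 : (K₁.card + 1) / 2 ≤ (bad i).card := by omega
        exact h1.trans (le_of_eq (congrArg Finset.card hb'))
      · intro k hk
        obtain ⟨E, hE, hEa⟩ := hac (jd k) (hjd k hk)
        have hsub : Ib.bipartiteBelow (fun i k => ¬ SignEq (D.a i (jd k)) v') k ⊆ E := by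
          intro i hi
          rw [Finset.mem_bipartiteBelow] at hi
          by_contra hiE
          exact hi.2 (hEa i (Finset.mem_filter.1 hi.1).1 hiE)
        exact (Finset.card_le_card hsub).trans hE
    rw [smul_eq_mul, smul_eq_mul] at hcount
    have hIb2 : Ib.card ≤ 2 * e := by
      by_contra hc
      push Not at hc
      have h1 : (2 * e + 1) * ((K₁.card + 1) / 2) ≤ K₁.card * e :=
        (Nat.mul_le_mul_right _ hc).trans hcount
      have h2 : K₁.card ≤ 2 * ((K₁.card + 1) / 2) := by omega
      nlinarith
    omega
  · by_cases hne : I₁.Nonempty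
    · obtain ⟨i₁, hi₁⟩ := hne
      refine D.sq_mul_min_le_of_rect hG Φ κ hκ hsep I₁ Finset.univ (fun j => D.a i₁ j) fun j _ i hi => ?_
      -- a common good column of `K₁` for `i` and `i₁`
      have hi' := (Finset.mem_filter.1 hi).2
      have hi₁' := (Finset.mem_filter.1 hi₁).2
      obtain ⟨k, hk, hkE⟩ := Finset.exists_mem_notMem_of_card_lt_card (s := bad i ∪ bad i₁) (t := K₁)
        (by have := Finset.card_union_le (bad i) (bad i₁); omega)
      rw [Finset.mem_union, not_or] at hkE
      have hg : ∀ i₂ ∈ I₁, k ∉ bad i₂ → D.c k i₂ = 0 := by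
        intro i₂ hi₂ hkb
        apply hpin k hk i₂ (hI₁sub hi₂)
        by_contra hna
        exact hkb (Finset.mem_filter.2 ⟨hk, hna⟩)
      exact D.a_signEq_a_of_c_zero (hg i hi hkE.1) (hg i₁ hi₁ hkE.2) j
    · rw [Finset.not_nonempty_iff_eq_empty] at hne
      rw [hne, Finset.card_empty, Nat.zero_min, mul_zero]; exact Nat.zero_le _

/-- **THEOREM 8.19, variant `v′ = v` (structural form).** `a ≈ [v]` on `I₀ × 𝓛`, `b ≈ [v]` on `𝓛 × K₀`, `v ≠ 0`:
`K₀ = K_c ⊔ K₊ ⊔ K₀'` with (T2a) on `K_c`, the 8.18 box bound on `K₊` (pinned to `[2v]`) and the rigid rectangle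
bound on `K₀'` (pinned to `[0]`). [C3-m2 §5.7] -/
theorem Data.nearRect_same [Fintype ι] [DecidableEq ι] [Fintype G₀] [DecidableEq G₀] [Fintype R]
    [DecidableEq R] [DecidableEq G] (hG : ∀ x : G, x = -x → x = 0) (D : Data ι G) (Φ : Chart ι G₀)
    (κ : G → R) (hκ : ∀ x y, κ x = κ y → SignEq x y) (hsep : D.SepAll Φ) {v : G} (hv : v ≠ 0)
    (I₀ L K₀ : Finset ι) (e : ℕ)
    (hac : ∀ j ∈ L, ∃ E : Finset ι, E.card ≤ e ∧ ∀ i ∈ I₀, i ∉ E → SignEq (D.a i j) v)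
    (har : ∀ i ∈ I₀, ∃ E : Finset ι, E.card ≤ e ∧ ∀ j ∈ L, j ∉ E → SignEq (D.a i j) v)
    (hbr : ∀ j ∈ L, ∃ E : Finset ι, E.card ≤ e ∧ ∀ k ∈ K₀, k ∉ E → SignEq (D.b j k) v)
    (hbc : ∀ k ∈ K₀, ∃ E : Finset ι, E.card ≤ e ∧ ∀ j ∈ L, j ∉ E → SignEq (D.b j k) v)
    (hL : 2 * e < L.card) :
    ∃ Kc ⊆ K₀, ∃ Kp ⊆ K₀, ∃ Kz ⊆ K₀, K₀.card = Kc.card + Kp.card + Kz.card ∧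
      Fintype.card ι * Kc.card * L.card ≤ Fintype.card R * Fintype.card G₀ ∧
      (2 * e < Kp.card → ∃ I₁ ⊆ I₀, I₀.card ≤ I₁.card + 2 * e ∧
        I₁.card * L.card * Kp.card ≤ Fintype.card G₀ + e * (L.card * Kp.card) +
          e * (L.card * I₁.card) + e * (Kp.card * L.card)) ∧
      (2 * e < Kz.card → ∃ I₁ ⊆ I₀, I₀.card ≤ I₁.card + 2 * e ∧
        Fintype.card ι ^ 2 * min I₁.card (Fintype.card ι / 2) ≤ 2 * (Fintype.card R * Fintype.card G₀)) := by
  classical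
  have hs : v + v ≠ 0 := add_self_ne_zero hG hv
  let jd : ι → ι := fun k => if h : ∃ j ∈ L, ¬ SignEq (D.b j k) v then h.choose else k
  have hjd : ∀ k, (∃ j ∈ L, ¬ SignEq (D.b j k) v) → jd k ∈ L ∧ ¬ SignEq (D.b (jd k) k) v := by
    intro k h
    have e1 : jd k = h.choose := dif_pos h
    rw [e1]; exact h.choose_spec
  set Kc : Finset ι := K₀.filter fun k => ∀ j ∈ L, SignEq (D.b j k) v with hKc
  set Kd : Finset ι := K₀.filter fun k => ¬ ∀ j ∈ L, SignEq (D.b j k) v with hKd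
  have hKd : ∀ k ∈ Kd, k ∈ K₀ ∧ jd k ∈ L ∧ ¬ SignEq (D.b (jd k) k) v := by
    intro k hk
    obtain ⟨hk₀, hne⟩ := Finset.mem_filter.1 hk
    push Not at hne
    exact ⟨hk₀, hjd k hne⟩
  set Kp : Finset ι := Kd.filter fun k => ∀ i ∈ I₀, SignEq (D.a i (jd k)) v → SignEq (D.c k i) (v + v)
    with hKp
  set Kz : Finset ι := Kd.filter fun k =>
    ¬ ∀ i ∈ I₀, SignEq (D.a i (jd k)) v → SignEq (D.c k i) (v + v) with hKz
  have hKpd : Kp ⊆ Kd := Finset.filter_subset _ _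
  have hKzd : Kz ⊆ Kd := Finset.filter_subset _ _
  have hKd₀ : Kd ⊆ K₀ := Finset.filter_subset _ _
  refine ⟨Kc, Finset.filter_subset _ _, Kp, hKpd.trans hKd₀, Kz, hKzd.trans hKd₀, ?_, ?_, ?_, ?_⟩
  · have h1 : Kc.card + Kd.card = K₀.card := Finset.card_filter_add_card_filter_not _
    have h2 : Kp.card + Kz.card = Kd.card := Finset.card_filter_add_card_filter_not _
    omega
  · exact D.card_mul_le_of_b_rowsOn₂ Φ κ hκ hsep L Kc fun j hj j' hj' k hk =>
      ((Finset.mem_filter.1 hk).2 j' hj').trans ((Finset.mem_filter.1 hk).2 j hj).symm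
  · intro hKp2
    refine D.nearRect_core hG Φ hsep hv hv hs I₀ L Kp e jd (fun k hk => (hKd k (hKpd hk)).2.1) hac har
      (fun j hj => ?_) (fun k hk => hbc k (hKd₀ (hKpd hk))) (fun k hk => (Finset.mem_filter.1 hk).2)
      hL hKp2
    obtain ⟨E, hE, hEb⟩ := hbr j hj
    exact ⟨E, hE, fun k hk hkE => hEb k (hKd₀ (hKpd hk)) hkE⟩
  · intro hKz2
    have hpin : ∀ k ∈ Kz, ∀ i ∈ I₀, SignEq (D.a i (jd k)) v → D.c k i = 0 := by
      intro k hk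
      obtain ⟨hkd, hno⟩ := Finset.mem_filter.1 hk
      obtain ⟨hk₀, hjL, hdev⟩ := hKd k hkd
      rcases D.c_row_pinned hG I₀ L e (fun h => hdev h.symm) har (hbc k hk₀) hL with h | h
      · exact absurd h hno
      · intro i hi hai
        have h0 := h i hi hai
        rw [sub_self] at h0
        rcases h0 with h0 | h0
        · exact h0
        · rw [neg_zero] at h0; exact h0
    exact D.sq_mul_min_le_of_zero_pinned hG Φ κ hκ hsep I₀ L Kz e jd (fun k hk => (hKd k (hKzd hk)).2.1)
      hac hpin hKz2

/-- **THEOREM 8.19, variant `v ∼ v′`** (reduce to `v′ = v` by `b ∼ v ⟺ b ∼ −v`). [C3-m2 §5.7] -/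
theorem Data.nearRect_signEq [Fintype ι] [DecidableEq ι] [Fintype G₀] [DecidableEq G₀] [Fintype R]
    [DecidableEq R] [DecidableEq G] (hG : ∀ x : G, x = -x → x = 0) (D : Data ι G) (Φ : Chart ι G₀)
    (κ : G → R) (hκ : ∀ x y, κ x = κ y → SignEq x y) (hsep : D.SepAll Φ) {v v' : G} (hv' : v' ≠ 0)
    (hvv : SignEq v v') (I₀ L K₀ : Finset ι) (e : ℕ)
    (hac : ∀ j ∈ L, ∃ E : Finset ι, E.card ≤ e ∧ ∀ i ∈ I₀, i ∉ E → SignEq (D.a i j) v')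
    (har : ∀ i ∈ I₀, ∃ E : Finset ι, E.card ≤ e ∧ ∀ j ∈ L, j ∉ E → SignEq (D.a i j) v')
    (hbr : ∀ j ∈ L, ∃ E : Finset ι, E.card ≤ e ∧ ∀ k ∈ K₀, k ∉ E → SignEq (D.b j k) v)
    (hbc : ∀ k ∈ K₀, ∃ E : Finset ι, E.card ≤ e ∧ ∀ j ∈ L, j ∉ E → SignEq (D.b j k) v)
    (hL : 2 * e < L.card) :
    ∃ Kc ⊆ K₀, ∃ Kp ⊆ K₀, ∃ Kz ⊆ K₀, K₀.card = Kc.card + Kp.card + Kz.card ∧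
      Fintype.card ι * Kc.card * L.card ≤ Fintype.card R * Fintype.card G₀ ∧
      (2 * e < Kp.card → ∃ I₁ ⊆ I₀, I₀.card ≤ I₁.card + 2 * e ∧
        I₁.card * L.card * Kp.card ≤ Fintype.card G₀ + e * (L.card * Kp.card) +
          e * (L.card * I₁.card) + e * (Kp.card * L.card)) ∧
      (2 * e < Kz.card → ∃ I₁ ⊆ I₀, I₀.card ≤ I₁.card + 2 * e ∧
        Fintype.card ι ^ 2 * min I₁.card (Fintype.card ι / 2) ≤ 2 * (Fintype.card R * Fintype.card G₀)) := by
  have hb : ∀ x : G, SignEq x v → SignEq x v' := fun x hx => hx.trans hvv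
  refine D.nearRect_same hG Φ κ hκ hsep hv' I₀ L K₀ e hac har (fun j hj => ?_) (fun k hk => ?_) hL
  · obtain ⟨E, hE, hEb⟩ := hbr j hj
    exact ⟨E, hE, fun k hk hkE => hb _ (hEb k hk hkE)⟩
  · obtain ⟨E, hE, hEb⟩ := hbc k hk
    exact ⟨E, hE, fun j hj hjE => hb _ (hEb j hj hjE)⟩

end FibreLines

end Summit.MatrixMultiplication.MatrixMultiplication.Theorems.TwistedTPP
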